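import Summits.QuantumAdvantage.QuantumAdvantage.Theorems.SosSandwichPseudoBoundedAALevelKRows
import HarnessLib

/-!
# Route `SosSandwich`, crux `PseudoBoundedAA` (stmt-QuantumAdvantage-15237): the LEVEL-`k` RUNG of the AA ladder
# ("low-level Aaronson–Ambainis")

Part 3 (parts 1, 2 = `…LevelKDecoupling.lean`, `…LevelKRows.lean`).  **For every `k ≥ 1`, every `[0,1]`-bounded
real polynomial `p` of total degree `≤ d` on `{0,1}^N` (`N ≥ 1`) has a variable with
`16·(k!)²·W_k[p]² ≤ 9^{k-1}·(2k+1)²·d^{4k-2}·Inf_i[p]`**, where `W_k[p] = Σ_{|S|=k} p̂(S)²` is the level-`k` Fourier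
weight: the Aaronson–Ambainis bound with the SHARP exponent `2` in the weight of ANY FIXED level, polynomially in
the degree (`k = 1, 2` recover, up to constants, `…LevelOneRung`, `…LevelTwoRung`).  The loss `3^k·d^{O(k)}` in
`k` is the printed obstruction for the middle levels (Bonami's constant; the Bohnenblust–Hille route of
arXiv:2608.04411 §1): the crux `AA_Q` is exactly "make this polynomial in `k`".

Proof (Littlewood's mixed-norm route): rows `r_i² = Σ_{S∋i,|S|=k} p̂(S)² ≤ Inf_i/4` (`four_mul_rowWeightK_le_influence`),
`Σ_i r_i² = k·W_k` (`sum_sum_filter_card_mem`), `Σ_i r_i ≤ 3^{k-1}(2k²+k)·L` with `L = d^{2k-1}/(2·k!)`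
(parts 1–2), so `k W_k ≤ r_max·3^{k-1}(2k²+k)L` and `4 r_max² ≤ Inf` — `exists_influence_ge_levelK`.

Honest label: a support lemma (the general bottom rung); no stub, crux or summit is proved.  Sources: O'Donnell
2014 Thm. 9.21, §2.2, §2.4; Korneichuk 1991 §3.5.4; Littlewood 1930; Aaronson–Ambainis 2014 Conj. 6.
-/

-- D-0017: single-conjunct summit ⇒ the duplicate `QuantumAdvantage.QuantumAdvantage` is mandated.
set_option linter.dupNamespace false

noncomputable section

namespace Summit.QuantumAdvantage.QuantumAdvantage.Theorems.SosSandwich.LevelKRung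

open Finset
open Literature.Computability.QuantumComplexity
open Literature.Computability.Complexity.LowDegree (cubeFourierCoeff sum_cubeFourierCoeff_mul_walsh
  sum_walsh_mul_walsh_index IsLevelLE isLevelLE_walsh cubeFourierCoeff_sum_mul_walsh)
open Literature.Probability.RandomGraphs.LowDegree (sgn walsh sgn_true sgn_false walsh_empty)
open Summit.QuantumAdvantage.QuantumAdvantage.Theorems.SosSandwich.LevelOneRung
open Literature.Computability.Cryptography (QQueryAlg)

variable {N : ℕ}

/-! ### The level-`k` rung -/

/-- Row weights are dominated by the influence: `4 Σ_{S ∋ i, |S| = k} p̂(S)² ≤ Inf_i[p]`.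
[cite: ODonnell2014, §2.2 (Fourier formula for influences)] -/
theorem four_mul_rowWeightK_le_influence (p : MvPolynomial (Fin N) ℝ) (k : ℕ) (i : Fin N) :
    4 * ∑ S ∈ univ.filter (fun S : Finset (Fin N) => S.card = k ∧ i ∈ S), cubeFourierCoeff (evalBool p) S ^ 2 ≤
      influence i p := by
  rw [influence_eq_sum_sq_fourier]
  refine mul_le_mul_of_nonneg_left ?_ (by norm_num)
  apply Finset.sum_le_sum_of_subset_of_nonneg
  · intro S hS
    rw [Finset.mem_filter] at hS ⊢
    exact ⟨hS.1, hS.2.2⟩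
  · intro S _ _
    exact sq_nonneg _

/-- Counting: `Σ_i Σ_{S ∋ i, |S| = k} a(S) = k · Σ_{|S| = k} a(S)`. [folklore] -/
theorem sum_sum_filter_card_mem (k : ℕ) (a : Finset (Fin N) → ℝ) :
    ∑ i, ∑ S ∈ univ.filter (fun S : Finset (Fin N) => S.card = k ∧ i ∈ S), a S =
      (k : ℝ) * ∑ S ∈ univ.filter (fun S : Finset (Fin N) => S.card = k), a S := by
  classical
  have e1 : ∀ i : Fin N, ∑ S ∈ univ.filter (fun S : Finset (Fin N) => S.card = k ∧ i ∈ S), a S =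
      ∑ S ∈ univ.filter (fun S : Finset (Fin N) => S.card = k), (if i ∈ S then a S else 0) := by
    intro i
    rw [Finset.sum_filter, Finset.sum_filter]
    refine Finset.sum_congr rfl fun S _ => ?_
    by_cases h1 : S.card = k <;> by_cases h2 : i ∈ S <;> simp [h1, h2]
  simp_rw [e1]
  rw [Finset.sum_comm, Finset.mul_sum]
  refine Finset.sum_congr rfl fun S hS => ?_
  rw [Finset.mem_filter] at hS
  rw [Finset.sum_ite_mem, Finset.univ_inter, Finset.sum_const, hS.2, nsmul_eq_mul]

/-- **The level-`k` rung ("low-level Aaronson–Ambainis").**  For `k ≥ 1` and a real polynomial `p` of total degree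
`≤ d` with `0 ≤ p ≤ 1` on `{0,1}^N`, `N ≥ 1`, some variable `i` has
`16·(k!)²·W_k[p]² ≤ 9^{k-1}·(2k+1)²·d^{4k-2}·Inf_i[p]`, `W_k[p] = Σ_{|S|=k} p̂(S)²`.
[cite: AaronsonAmbainis2014, Conj. 6] [cite: ODonnell2014, Thm. 9.21, §2.2] [cite: Korneichuk1991, §3.5.4] -/
theorem exists_influence_ge_levelK {d k : ℕ} (hk : 1 ≤ k) {p : MvPolynomial (Fin N) ℝ} (hN : 0 < N)
    (hp : p.totalDegree ≤ d) (hb : ∀ x, 0 ≤ evalBool p x ∧ evalBool p x ≤ 1) :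
    ∃ i : Fin N, 16 * (k.factorial : ℝ) ^ 2 *
        (∑ S ∈ univ.filter (fun S : Finset (Fin N) => S.card = k), cubeFourierCoeff (evalBool p) S ^ 2) ^ 2 ≤
      (9 : ℝ) ^ (k - 1) * (2 * k + 1) ^ 2 * (d : ℝ) ^ (4 * k - 2) * influence i p := by
  classical
  haveI : Nonempty (Fin N) := Fin.pos_iff_nonempty.mp hN
  -- the centred function and the sup bound of its level-`k` part
  have hM : ∀ x, |evalBool p x - 1 / 2| ≤ 1 / 2 := fun x => by
    rw [abs_le]; constructor <;> linarith [(hb x).1, (hb x).2]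
  have hdeg : IsLevelLE d (fun x => evalBool p x - 1 / 2) := fun S hS => by
    have hS0 : S ≠ ∅ := by rintro rfl; simp at hS
    rw [cubeFourierCoeff_sub_const _ hS0]
    exact cubeFourierCoeff_evalBool_eq_zero hp hS
  have hcoef : ∀ S : Finset (Fin N), S.card = k →
      cubeFourierCoeff (fun x => evalBool p x - 1 / 2) S = cubeFourierCoeff (evalBool p) S := by
    intro S hS
    refine cubeFourierCoeff_sub_const _ ?_
    rintro rfl; simp at hS; omega
  set L : ℝ := (d : ℝ) ^ (2 * k - 1) * (1 / 2) / k.factorial with hL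
  have hLsup := abs_levelK_sum_le hdeg hM hk
  -- rows of `p` (the level-`k` coefficients of `p` and of `p - 1/2` agree)
  have hrows : ∀ u : Fin N → Bool,
      ∑ i, |∑ S ∈ univ.filter (fun S : Finset (Fin N) => S.card = k ∧ i ∈ S),
        cubeFourierCoeff (evalBool p) S * walsh (S.erase i) u| ≤ (2 * (k : ℝ) ^ 2 + k) * L := by
    intro u
    have h := sum_abs_row_le hLsup u
    have e : ∀ i, ∑ S ∈ univ.filter (fun S : Finset (Fin N) => S.card = k ∧ i ∈ S),
        cubeFourierCoeff (fun x => evalBool p x - 1 / 2) S * walsh (S.erase i) u =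
        ∑ S ∈ univ.filter (fun S : Finset (Fin N) => S.card = k ∧ i ∈ S),
          cubeFourierCoeff (evalBool p) S * walsh (S.erase i) u := fun i =>
      Finset.sum_congr rfl fun S hS => by rw [hcoef S (Finset.mem_filter.mp hS).2.1]
    simp_rw [e] at h
    exact h
  -- `r_i`, `Σ r_i ≤ 3^{k-1}(2k²+k)L`, `Σ r_i² = k W_k`
  set R : Fin N → ℝ := fun i => ∑ S ∈ univ.filter (fun S : Finset (Fin N) => S.card = k ∧ i ∈ S),
    cubeFourierCoeff (evalBool p) S ^ 2 with hR
  set r : Fin N → ℝ := fun i => Real.sqrt (R i) with hr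
  have hR0 : ∀ j, 0 ≤ R j := fun j => Finset.sum_nonneg fun S _ => sq_nonneg _
  have hr0 : ∀ j, 0 ≤ r j := fun j => Real.sqrt_nonneg _
  have hrsq : ∀ j, r j ^ 2 = R j := fun j => Real.sq_sqrt (hR0 j)
  set A : ℝ := (3 : ℝ) ^ (k - 1) * ((2 * (k : ℝ) ^ 2 + k) * L) with hA
  have hsumr : ∑ j, r j ≤ A := by
    have h2N : (0 : ℝ) < (2 : ℝ) ^ N := by positivity
    have h1 : ∀ j, (2 : ℝ) ^ N * r j ≤ (3 : ℝ) ^ (k - 1) * ∑ u : Fin N → Bool,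
        |∑ S ∈ univ.filter (fun S : Finset (Fin N) => S.card = k ∧ j ∈ S),
          cubeFourierCoeff (evalBool p) S * walsh (S.erase j) u| := fun j => khintchine_row (evalBool p) k j
    have h2 : (2 : ℝ) ^ N * ∑ j, r j ≤ (3 : ℝ) ^ (k - 1) * ∑ u : Fin N → Bool, ∑ j,
        |∑ S ∈ univ.filter (fun S : Finset (Fin N) => S.card = k ∧ j ∈ S),
          cubeFourierCoeff (evalBool p) S * walsh (S.erase j) u| := by
      rw [Finset.mul_sum, Finset.sum_comm, Finset.mul_sum]
      exact Finset.sum_le_sum fun j _ => h1 j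
    have h3 : ∑ u : Fin N → Bool, ∑ j,
        |∑ S ∈ univ.filter (fun S : Finset (Fin N) => S.card = k ∧ j ∈ S),
          cubeFourierCoeff (evalBool p) S * walsh (S.erase j) u| ≤ (2 : ℝ) ^ N * ((2 * (k : ℝ) ^ 2 + k) * L) := by
      have hc : ∑ _u : Fin N → Bool, ((2 * (k : ℝ) ^ 2 + k) * L) = (2 : ℝ) ^ N * ((2 * (k : ℝ) ^ 2 + k) * L) := by
        simp [Finset.card_univ, Fintype.card_fin]
      rw [← hc]
      exact Finset.sum_le_sum fun u _ => hrows u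
    have h39 : (0 : ℝ) ≤ (3 : ℝ) ^ (k - 1) := by positivity
    have h4 : (2 : ℝ) ^ N * ∑ j, r j ≤ (2 : ℝ) ^ N * A := by
      calc (2 : ℝ) ^ N * ∑ j, r j ≤ _ := h2
        _ ≤ (3 : ℝ) ^ (k - 1) * ((2 : ℝ) ^ N * ((2 * (k : ℝ) ^ 2 + k) * L)) := mul_le_mul_of_nonneg_left h3 h39
        _ = (2 : ℝ) ^ N * A := by rw [hA]; ring
    exact le_of_mul_le_mul_left h4 h2N
  set W := ∑ S ∈ univ.filter (fun S : Finset (Fin N) => S.card = k), cubeFourierCoeff (evalBool p) S ^ 2 with hW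
  have hkW : ∑ j, r j ^ 2 = (k : ℝ) * W := by
    simp_rw [hrsq]
    exact sum_sum_filter_card_mem k (fun S => cubeFourierCoeff (evalBool p) S ^ 2)
  -- the maximal row
  obtain ⟨i, -, hi⟩ := Finset.exists_max_image Finset.univ r Finset.univ_nonempty
  refine ⟨i, ?_⟩
  have hmax : ∀ j, r j ≤ r i := fun j => hi j (Finset.mem_univ j)
  have hsq_le : (k : ℝ) * W ≤ r i * A := by
    rw [← hkW]
    calc ∑ j, r j ^ 2 = ∑ j, r j * r j := Finset.sum_congr rfl fun j _ => sq (r j)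
      _ ≤ ∑ j, r i * r j := Finset.sum_le_sum fun j _ => mul_le_mul_of_nonneg_right (hmax j) (hr0 j)
      _ = r i * ∑ j, r j := by rw [Finset.mul_sum]
      _ ≤ r i * A := mul_le_mul_of_nonneg_left hsumr (hr0 i)
  have hinf : 4 * r i ^ 2 ≤ influence i p := by
    rw [hrsq]; exact four_mul_rowWeightK_le_influence p k i
  have hW0 : 0 ≤ W := Finset.sum_nonneg fun S _ => sq_nonneg _
  have hk0 : (0 : ℝ) < k := by exact_mod_cast hk
  have hsq : ((k : ℝ) * W) ^ 2 ≤ (r i * A) ^ 2 := pow_le_pow_left₀ (by positivity) hsq_le 2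
  -- `4 (k!)² A² = 9^{k-1} k² (2k+1)² d^{4k-2}`
  have hfac : (0 : ℝ) < (k.factorial : ℝ) := by positivity
  have hfac0 : (k.factorial : ℝ) ≠ 0 := ne_of_gt hfac
  have hA2 : A ^ 2 * (4 * (k.factorial : ℝ) ^ 2) =
      (9 : ℝ) ^ (k - 1) * (k : ℝ) ^ 2 * (2 * k + 1) ^ 2 * (d : ℝ) ^ (4 * k - 2) := by
    have e9 : ((3 : ℝ) ^ (k - 1)) ^ 2 = (9 : ℝ) ^ (k - 1) := by
      rw [← pow_mul, show (9 : ℝ) = 3 ^ 2 by norm_num, ← pow_mul]; ring_nf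
    have ed : ((d : ℝ) ^ (2 * k - 1)) ^ 2 = (d : ℝ) ^ (4 * k - 2) := by
      rw [← pow_mul]; congr 1; omega
    have eA : A = (3 : ℝ) ^ (k - 1) * ((k : ℝ) * (2 * k + 1)) * (d : ℝ) ^ (2 * k - 1) / (2 * k.factorial) := by
      rw [hA, hL]; field_simp
    rw [eA, ← e9, ← ed]
    field_simp
    ring
  have hX0 : (0 : ℝ) ≤ (9 : ℝ) ^ (k - 1) * (k : ℝ) ^ 2 * (2 * k + 1) ^ 2 * (d : ℝ) ^ (4 * k - 2) := by positivity
  -- conclude: `16 (k!)² W² ≤ 9^{k-1}(2k+1)² d^{4k-2} Inf`, cancelling `k² > 0`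
  have key : (k : ℝ) ^ 2 * (16 * (k.factorial : ℝ) ^ 2 * W ^ 2) ≤
      (k : ℝ) ^ 2 * ((9 : ℝ) ^ (k - 1) * (2 * k + 1) ^ 2 * (d : ℝ) ^ (4 * k - 2) * influence i p) := by
    have h1 : ((k : ℝ) * W) ^ 2 * (16 * (k.factorial : ℝ) ^ 2) ≤ (r i * A) ^ 2 * (16 * (k.factorial : ℝ) ^ 2) :=
      mul_le_mul_of_nonneg_right hsq (by positivity)
    have h2 : (r i * A) ^ 2 * (16 * (k.factorial : ℝ) ^ 2) =
        (4 * r i ^ 2) * ((9 : ℝ) ^ (k - 1) * (k : ℝ) ^ 2 * (2 * k + 1) ^ 2 * (d : ℝ) ^ (4 * k - 2)) := by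
      rw [← hA2]; ring
    have h3 : (4 * r i ^ 2) * ((9 : ℝ) ^ (k - 1) * (k : ℝ) ^ 2 * (2 * k + 1) ^ 2 * (d : ℝ) ^ (4 * k - 2)) ≤
        influence i p * ((9 : ℝ) ^ (k - 1) * (k : ℝ) ^ 2 * (2 * k + 1) ^ 2 * (d : ℝ) ^ (4 * k - 2)) :=
      mul_le_mul_of_nonneg_right hinf hX0
    calc (k : ℝ) ^ 2 * (16 * (k.factorial : ℝ) ^ 2 * W ^ 2)
        = ((k : ℝ) * W) ^ 2 * (16 * (k.factorial : ℝ) ^ 2) := by ring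
      _ ≤ influence i p * ((9 : ℝ) ^ (k - 1) * (k : ℝ) ^ 2 * (2 * k + 1) ^ 2 * (d : ℝ) ^ (4 * k - 2)) := by
          rw [h2] at h1; exact h1.trans h3
      _ = (k : ℝ) ^ 2 * ((9 : ℝ) ^ (k - 1) * (2 * k + 1) ^ 2 * (d : ℝ) ^ (4 * k - 2) * influence i p) := by
          ring
  exact le_of_mul_le_mul_left key (by positivity)


/-! ### Consequences on `Q_T`: every level carries a rung; `AA_Q` with the sharp `ε`-exponent and `T^{O(T)}` loss -/

/-- **The level-`k` rung on `Q_T`** (`d = 2T`): for a `T`-query quantum algorithm on `N ≥ 1` bits and a real polynomial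
`p` with its acceptance probabilities as cube values, some variable has
`16·(k!)²·W_k[p]² ≤ 9^{k-1}·(2k+1)²·(2T)^{4k-2}·Inf_i[p]`. [cite: BealsEtAl2001, Lemma 4.1] [cite: AaronsonAmbainis2014, Conj. 6] -/
theorem exists_influence_ge_levelK_query {k : ℕ} (hk : 1 ≤ k) (hN : 0 < N) (Q : QQueryAlg N)
    (p : MvPolynomial (Fin N) ℝ) (hp : ∀ x, evalBool p x = Q.acceptProb x) :
    ∃ i : Fin N, 16 * (k.factorial : ℝ) ^ 2 *
        (∑ S ∈ univ.filter (fun S : Finset (Fin N) => S.card = k), cubeFourierCoeff (evalBool p) S ^ 2) ^ 2 ≤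
      (9 : ℝ) ^ (k - 1) * (2 * k + 1) ^ 2 * ((2 * Q.queries : ℕ) : ℝ) ^ (4 * k - 2) * influence i p := by
  obtain ⟨p₀, hdeg, hval⟩ := exists_acceptPolynomial Q
  have heq : evalBool p = evalBool p₀ := funext fun x => by rw [hp x]; exact hval x
  have hb : ∀ x, 0 ≤ evalBool p₀ x ∧ evalBool p₀ x ≤ 1 := fun x => by
    have hx : evalBool p₀ x = Q.acceptProb x := (hval x).symm
    rw [hx]
    exact ⟨Q.acceptProb_nonneg x, Q.acceptProb_le_one' x⟩
  obtain ⟨i, hi⟩ := exists_influence_ge_levelK hk hN hdeg hb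
  refine ⟨i, ?_⟩
  have hinf : influence i p = influence i p₀ := by unfold influence; rw [heq]
  rw [heq, hinf]
  exact hi

/-- **Variance in the Walsh basis**, filter form: `Var[p] = Σ_{S ≠ ∅} p̂(S)²`. [cite: ODonnell2014, §1.4 (Parseval)] -/
theorem boolVariance_eq_sum_nonempty (p : MvPolynomial (Fin N) ℝ) :
    boolVariance p = ∑ S ∈ univ.filter (fun S : Finset (Fin N) => S ≠ ∅), cubeFourierCoeff (evalBool p) S ^ 2 := by
  classical
  set c := boolAvg (evalBool p) with hc
  have hV : boolVariance p = (∑ x, (evalBool p x - c) ^ 2) / 2 ^ N := rfl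
  rw [hV, ← Literature.Computability.Complexity.LowDegree.sum_cubeFourierCoeff_sq (fun x => evalBool p x - c)]
  rw [← Finset.sum_filter_add_sum_filter_not univ (fun S : Finset (Fin N) => S ≠ ∅)]
  have hset : univ.filter (fun S : Finset (Fin N) => ¬ S ≠ ∅) = {∅} := by ext S; simp
  have h0 : cubeFourierCoeff (fun x => evalBool p x - c) ∅ = 0 := by
    rw [Literature.Computability.Complexity.LowDegree.cubeFourierCoeff_empty, Finset.sum_sub_distrib,
      Finset.sum_const, nsmul_eq_mul]
    have hcard : ((Finset.univ : Finset (Fin N → Bool)).card : ℝ) = (2 : ℝ) ^ N := by simp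
    rw [hcard, hc]
    unfold boolAvg
    field_simp
    ring
  rw [hset, Finset.sum_singleton, h0]
  simp only [ne_eq, zero_pow two_ne_zero, add_zero]
  refine Finset.sum_congr rfl fun S hS => ?_
  rw [Finset.mem_filter] at hS
  rw [cubeFourierCoeff_sub_const _ hS.2]

/-- The variance of a cube function of Fourier degree `≤ d` is carried by the levels `1 … d`:
`Var[p] ≤ Σ_{k=1}^{d} W_k[p]` (in fact equality). [cite: ODonnell2014, §1.4 (Parseval)] -/
theorem boolVariance_le_sum_levels (p : MvPolynomial (Fin N) ℝ) {d : ℕ}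
    (hd : ∀ S : Finset (Fin N), d < S.card → cubeFourierCoeff (evalBool p) S = 0) :
    boolVariance p ≤ ∑ k ∈ Finset.Icc 1 d,
      ∑ S ∈ univ.filter (fun S : Finset (Fin N) => S.card = k), cubeFourierCoeff (evalBool p) S ^ 2 := by
  classical
  rw [boolVariance_eq_sum_nonempty p]
  -- fibre the nonempty sets with nonzero coefficient by their size
  have hfib : ∑ S ∈ univ.filter (fun S : Finset (Fin N) => S ≠ ∅), cubeFourierCoeff (evalBool p) S ^ 2 =
      ∑ S ∈ univ.filter (fun S : Finset (Fin N) => S ≠ ∅ ∧ S.card ≤ d), cubeFourierCoeff (evalBool p) S ^ 2 := by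
    rw [← Finset.sum_filter_add_sum_filter_not (univ.filter (fun S : Finset (Fin N) => S ≠ ∅))
      (fun S => S.card ≤ d)]
    have hz : ∑ S ∈ (univ.filter (fun S : Finset (Fin N) => S ≠ ∅)).filter (fun S => ¬ S.card ≤ d),
        cubeFourierCoeff (evalBool p) S ^ 2 = 0 := by
      refine Finset.sum_eq_zero fun S hS => ?_
      rw [Finset.mem_filter] at hS
      rw [hd S (by omega), zero_pow two_ne_zero]
    rw [hz, add_zero, Finset.filter_filter]
  rw [hfib]
  rw [← Finset.sum_fiberwise_of_maps_to (s := univ.filter (fun S : Finset (Fin N) => S ≠ ∅ ∧ S.card ≤ d))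
    (t := Finset.Icc 1 d) (g := fun S => S.card) (f := fun S => cubeFourierCoeff (evalBool p) S ^ 2) ?_]
  · refine Finset.sum_le_sum fun k hk => ?_
    apply Finset.sum_le_sum_of_subset_of_nonneg
    · intro S hS
      simp only [Finset.mem_filter, Finset.mem_univ, true_and] at hS ⊢
      exact hS.2
    · intro S _ _; exact sq_nonneg _
  · intro S hS
    simp only [Finset.mem_filter, Finset.mem_univ, true_and] at hS
    rw [Finset.mem_Icc]
    exact ⟨Finset.card_pos.mpr (Finset.nonempty_of_ne_empty hS.1), hS.2⟩

/-- **Aaronson–Ambainis with the SHARP `ε`-exponent and a `d^{O(d)}` loss, unconditionally.**  For a real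
polynomial `p` of total degree `≤ d` (`d ≥ 1`) with `0 ≤ p ≤ 1` on `{0,1}^N`, `N ≥ 1`, some variable has
`16·Var[p]² ≤ 9^{d-1}·(2d+1)²·d^{4d}·Inf_i[p]` (pigeonhole over the `d` levels, then the level-`k` rung) — the
`ε`-sharp counterpart of the Dinur–Friedgut–Kindler–O'Donnell bound `Var³/2^{O(d)}`.
[cite: AaronsonAmbainis2014, Conj. 6] [cite: ODonnell2014, Thm. 9.21] [cite: DinurEtAl2007, Thm. 3] -/
theorem exists_influence_sharp_exponent {d : ℕ} (hd1 : 1 ≤ d) {p : MvPolynomial (Fin N) ℝ} (hN : 0 < N)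
    (hp : p.totalDegree ≤ d) (hb : ∀ x, 0 ≤ evalBool p x ∧ evalBool p x ≤ 1) :
    ∃ i : Fin N, 16 * boolVariance p ^ 2 ≤
      (9 : ℝ) ^ (d - 1) * (2 * (d : ℝ) + 1) ^ 2 * (d : ℝ) ^ (4 * d) * influence i p := by
  classical
  have hdeg : ∀ S : Finset (Fin N), d < S.card → cubeFourierCoeff (evalBool p) S = 0 :=
    fun S hS => cubeFourierCoeff_evalBool_eq_zero hp hS
  have hsum := boolVariance_le_sum_levels p hdeg
  set W : ℕ → ℝ := fun k =>
    ∑ S ∈ univ.filter (fun S : Finset (Fin N) => S.card = k), cubeFourierCoeff (evalBool p) S ^ 2 with hW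
  have hne : (Finset.Icc 1 d).Nonempty := ⟨1, Finset.mem_Icc.mpr ⟨le_rfl, hd1⟩⟩
  have hpig : ∃ k ∈ Finset.Icc 1 d, boolVariance p / d ≤ W k := by
    apply Finset.exists_le_of_sum_le hne
    rw [Finset.sum_const, Nat.card_Icc, nsmul_eq_mul]
    have : ((d + 1 - 1 : ℕ) : ℝ) * (boolVariance p / d) = boolVariance p := by
      rw [show d + 1 - 1 = d by omega]
      field_simp
    rw [this]
    exact hsum
  obtain ⟨k, hk, hWk⟩ := hpig
  rw [Finset.mem_Icc] at hk
  obtain ⟨i, hi⟩ := exists_influence_ge_levelK hk.1 hN hp hb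
  refine ⟨i, ?_⟩
  have hI := influence_nonneg i p
  have hV0 := boolVariance_nonneg p
  have hdpos : (0 : ℝ) < d := by exact_mod_cast hd1
  have hd1r : (1 : ℝ) ≤ d := by exact_mod_cast hd1
  -- `(Var/d)² ≤ W_k² ≤ (k!)² W_k²`
  have hWk0 : 0 ≤ W k := Finset.sum_nonneg fun S _ => sq_nonneg _
  have h1 : (boolVariance p / d) ^ 2 ≤ W k ^ 2 := pow_le_pow_left₀ (by positivity) hWk 2
  have hfac : (1 : ℝ) ≤ (k.factorial : ℝ) := by exact_mod_cast Nat.succ_le_of_lt (Nat.factorial_pos k)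
  have h2 : W k ^ 2 ≤ (k.factorial : ℝ) ^ 2 * W k ^ 2 := by
    have : (1 : ℝ) ≤ (k.factorial : ℝ) ^ 2 := one_le_pow₀ hfac
    nlinarith [sq_nonneg (W k)]
  -- monotonicity of the constant in `k ≤ d`
  have h9 : (9 : ℝ) ^ (k - 1) ≤ (9 : ℝ) ^ (d - 1) := pow_le_pow_right₀ (by norm_num) (by omega)
  have hk2 : ((2 : ℝ) * k + 1) ^ 2 ≤ (2 * (d : ℝ) + 1) ^ 2 := by
    have : (k : ℝ) ≤ d := by exact_mod_cast hk.2
    nlinarith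
  have hdd : (d : ℝ) ^ (4 * k - 2) ≤ (d : ℝ) ^ (4 * d - 2) := pow_le_pow_right₀ hd1r (by omega)
  have hC : (9 : ℝ) ^ (k - 1) * (2 * k + 1) ^ 2 * (d : ℝ) ^ (4 * k - 2) ≤
      (9 : ℝ) ^ (d - 1) * (2 * (d : ℝ) + 1) ^ 2 * (d : ℝ) ^ (4 * d - 2) := by
    gcongr
  have step : 16 * boolVariance p ^ 2 ≤
      (d : ℝ) ^ 2 * ((9 : ℝ) ^ (d - 1) * (2 * (d : ℝ) + 1) ^ 2 * (d : ℝ) ^ (4 * d - 2) * influence i p) := by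
    have e : 16 * boolVariance p ^ 2 = (d : ℝ) ^ 2 * (16 * (boolVariance p / d) ^ 2) := by
      field_simp
    rw [e]
    refine mul_le_mul_of_nonneg_left ?_ (by positivity)
    calc 16 * (boolVariance p / d) ^ 2 ≤ 16 * (k.factorial : ℝ) ^ 2 * W k ^ 2 := by nlinarith [h1, h2]
      _ ≤ (9 : ℝ) ^ (k - 1) * (2 * k + 1) ^ 2 * (d : ℝ) ^ (4 * k - 2) * influence i p := hi
      _ ≤ (9 : ℝ) ^ (d - 1) * (2 * (d : ℝ) + 1) ^ 2 * (d : ℝ) ^ (4 * d - 2) * influence i p :=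
          mul_le_mul_of_nonneg_right hC hI
  have hexp : (d : ℝ) ^ 2 * (d : ℝ) ^ (4 * d - 2) = (d : ℝ) ^ (4 * d) := by
    rw [← pow_add]; congr 1; omega
  calc 16 * boolVariance p ^ 2 ≤ _ := step
    _ = (9 : ℝ) ^ (d - 1) * (2 * (d : ℝ) + 1) ^ 2 * ((d : ℝ) ^ 2 * (d : ℝ) ^ (4 * d - 2)) * influence i p := by
        ring
    _ = (9 : ℝ) ^ (d - 1) * (2 * (d : ℝ) + 1) ^ 2 * (d : ℝ) ^ (4 * d) * influence i p := by rw [hexp]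

/-- **`AA_Q` with the SHARP `ε`-exponent and a `T^{O(T)}` loss, unconditionally.**  For every quantum algorithm
making `T ≥ 1` queries to `N ≥ 1` bits and every real polynomial `p` with its acceptance probabilities as cube values,
some variable has `16·Var[p]² ≤ 9^{2T-1}·(4T+1)²·(2T)^{8T}·Inf_i[p]` — the `ε`-sharp counterpart (`Var²`, optimal by
`MeanSquare.aaQuery_exponent_ge_two`) of the tree's DFKO-based `QueryPathBridge.aaQuery_expLoss` (`ε^a/2^{O(T)}`);
the crux `AA_Q` asks to replace `T^{O(T)}` by `poly(T)`. [cite: AaronsonAmbainis2014, Conj. 6]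
[cite: ODonnell2014, Thm. 9.21] [cite: BealsEtAl2001, Lemma 4.1] -/
theorem aaQuery_sharp_exponent (hN : 0 < N) (Q : QQueryAlg N) (hT : 1 ≤ Q.queries)
    (p : MvPolynomial (Fin N) ℝ) (hp : ∀ x, evalBool p x = Q.acceptProb x) :
    ∃ i : Fin N, 16 * boolVariance p ^ 2 ≤
      (9 : ℝ) ^ (2 * Q.queries - 1) * (2 * ((2 * Q.queries : ℕ) : ℝ) + 1) ^ 2 *
        ((2 * Q.queries : ℕ) : ℝ) ^ (4 * (2 * Q.queries)) * influence i p := by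
  obtain ⟨p₀, hdeg, hval⟩ := exists_acceptPolynomial Q
  have heq : evalBool p = evalBool p₀ := funext fun x => by rw [hp x]; exact hval x
  have hb : ∀ x, 0 ≤ evalBool p₀ x ∧ evalBool p₀ x ≤ 1 := fun x => by
    have hx : evalBool p₀ x = Q.acceptProb x := (hval x).symm
    rw [hx]
    exact ⟨Q.acceptProb_nonneg x, Q.acceptProb_le_one' x⟩
  obtain ⟨i, hi⟩ := exists_influence_sharp_exponent (by omega) hN hdeg hb
  refine ⟨i, ?_⟩
  have hinf : influence i p = influence i p₀ := by unfold influence; rw [heq]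
  have hvar : boolVariance p = boolVariance p₀ := by unfold boolVariance; rw [heq]
  rw [hvar, hinf]
  exact hi

/-- **PB-AA with the SHARP `ε`-exponent at every fixed order, unconditionally** (`K_T`, `d = 2T`): every
pseudo-bounded `p` of order `T ≥ 1` on `N ≥ 1` bits has a variable with
`16·Var[p]² ≤ 9^{2T-1}·(4T+1)²·(2T)^{8T}·Inf_i[p]` — compare the tree's `pseudoBoundedAA_dfko` (`ε³/2^{42T}`); the crux
`PseudoBoundedAA` (stmt-QuantumAdvantage-15237) asks for `poly(T)`. [cite: AaronsonAmbainis2014, Conj. 6]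
[cite: KaniewskiLeeDewolf2015, Def. 7] [cite: ODonnell2014, Thm. 9.21] -/
theorem pseudoBoundedAA_sharp_exponent {T : ℕ} (hT : 1 ≤ T) {p : MvPolynomial (Fin N) ℝ} (hN : 0 < N)
    (h : PseudoBounded T p) :
    ∃ i : Fin N, 16 * boolVariance p ^ 2 ≤
      (9 : ℝ) ^ (2 * T - 1) * (2 * ((2 * T : ℕ) : ℝ) + 1) ^ 2 * ((2 * T : ℕ) : ℝ) ^ (4 * (2 * T)) * influence i p := by
  obtain ⟨p', hdeg, hb, heq⟩ := exists_representative_of_pseudoBounded h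
  obtain ⟨i, hi⟩ := exists_influence_sharp_exponent (by omega) hN hdeg hb
  refine ⟨i, ?_⟩
  have hinf : influence i p' = influence i p := by unfold influence; rw [heq]
  have hvar : boolVariance p' = boolVariance p := by unfold boolVariance; rw [heq]
  rw [hvar, hinf] at hi
  exact hi

end Summit.QuantumAdvantage.QuantumAdvantage.Theorems.SosSandwich.LevelKRung
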